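import Summits.Ventures.AbcSig.Rows.TemplateAB
import Summits.Ventures.AbcSig.Levels.N283
import Summits.Ventures.AbcSig.Levels.N566

/-!
# Venture AbcSig — ROW `C2aL283A6AB`: `283^m·xⁿ + 2^a·yⁿ = z²` (SECOND coefficient distribution of the cell; the distribution `xⁿ + 2^a·283^m·yⁿ = z²` is `Rows/C2aL283A6.lean`), class `a ge6` (GENERATED by plean/leanrow.py)

HONEST FRAMING. A row of a COMPUTATION cell (`pub-abcsig`); a CONDITIONAL theorem, no claim on ABC or any summit.
Hypotheses: `BS04Package` (CITED), `DataComplete` at levels [283, 566] (COMPUTED, two-engine certified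
level files), and the listed per-orbit exclusions `hX_…` (CITED — e.g. the cell's M6 Eisenstein certificates; the
row's R5 cell names each). Everything else is kernel-checked (`Rows/TemplateAB.lean`, `Levels/N….lean` — the SAME level files as the first distribution). Exponent
range: prime `n ≥ 11`, `n ≠ 283`; `B = 2^a 283^m` with `a, m < n` (n-th-power free).

-/

namespace Summit.Ventures.AbcSig

/-- Row `C2aL283A6AB`: second coefficient distribution `283^m·xⁿ + 2^a·yⁿ = z²` (see module docstring). -/
theorem row_C2aL283A6AB (M : NewformModel) (hP : M.BS04Package)
    (hD283 : M.DataComplete 283 level283Orbits) (hD566 : M.DataComplete 566 level566Orbits)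
    (n : ℕ) (hn : n.Prime) (hmin : 11 ≤ n) (hnℓ : n ≠ 283) (a m : ℕ) (ha : 6 ≤ a) (hm : 1 ≤ m) (han : a < n) (hmn : m < n)
    (hX_orbit_283_2 : n ∈ ([47] : List ℕ) → M.Excludes 283 orbit_283_2 (famAB (283 ^ m) (2 ^ a) n (fun _ _ => True)))
    (hX_orbit_566_7 : n ∈ ([7, 71] : List ℕ) → M.Excludes 566 orbit_566_7 (famAB (283 ^ m) (2 ^ a) n (fun _ _ => True)))
    (x y z : ℤ) (hxy1 : x * y ≠ 1) (hxy2 : x * y ≠ -1) : ¬ IsPrimitiveSolution (283 ^ m) (2 ^ a) 1 n x y z := by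
  have hℓ : Nat.Prime 283 := by norm_num
  have h7 : 7 ≤ n := by omega
  have hS283 :=
    (level283_sieve n hn h7 (fun o => M.Excludes 283 o (famAB (283 ^ m) (2 ^ a) n (fun _ _ => True))) hX_orbit_283_2)
  have hS566 :=
    (level566_sieve n hn h7 (fun o => M.Excludes 566 o (famAB (283 ^ m) (2 ^ a) n (fun _ _ => True))) (fun h => absurd h (by simp only [List.mem_cons, List.not_mem_nil, or_false]; omega)) (fun h => absurd h (by simp only [List.mem_cons, List.not_mem_nil, or_false]; omega)) hX_orbit_566_7)
  by_cases ha6 : a = 6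
  · subst ha6
    exact rowC2aAB_a6 283 hℓ (by norm_num) M hP n hn h7 hnℓ hD283 hD566 m hm hmn
      hS283
      hS566 x y z hxy1 hxy2
  · exact rowC2aAB_age7 283 hℓ (by norm_num) M hP n hn h7 hnℓ hD566 a m (by omega) hm han hmn
      hS566 x y z hxy1 hxy2

end Summit.Ventures.AbcSig
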